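import Summits.QuantumFields.YangMills.Theorems.BalabanUVNodesN20HellingerEndpointKernel
import Mathlib.Analysis.Convex.SpecificFunctions.Basic
import Mathlib.Analysis.Convex.Jensen
import Mathlib.Analysis.Calculus.MeanValue

/-!
# BalabanUVNodes ∕ node N20 (NE7b) — THE HELLINGER ROAD'S ENDPOINT KERNEL, PART 2 (the two runs' class weights at ONE key): the Gibbs–Bogoliubov SANDWICH by
# Jensen, the V-side in increment letters, the bootstrap at the class weights, and the ENDPOINT RESPONSE IDENTITY for the target constant `c = log Z_B − log Z_A`

Cell `pub-ymgap` (HUMAN RULING D-0062 Track A ∕ director-ym R399 (3a) second-wave width seats), WIDTH SEAT `pub-ymgap-dag-n20-w5` (node n20 = NE7b),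
generation g3, CLAIM-1 ∕ INTENT-1 (bus 2026-08-28T08:01:44Z), FILE 1b of 3.  Key item K3⁷ `SpineGivenEndpointR13SepCoPH` (stmt-QuantumFields-20544; skeleton of
record v5 941dddb108cbaacf, stub 2 `stub_expansion13H`); filed `--kind proof --supports … --as helper`.  COUNT-NEUTRAL.  THEOREMS ONLY (0 `def`, 0 `instance`,
0 `notation`, 0 `sorry`).  ADDITIVE — imports FILE 1a `…N20HellingerEndpointKernel` (two laws: coupling lemma, bootstrap, Padé V-side; through it dag-n19-w2's
`…N19AffinityClassIndexLaws`, p612301, whose `div_total_nonneg` ∕ `sum_div_total_eq_one` are used BY NAME) + Mathlib (Jensen, MVT).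

WHY (see FILE 1a).  At the two runs' positive class weights `A, B` on the keyed class set `T` — `p = A∕Z_A`, `q = B∕Z_B` the two ONE-RUN class laws,
`h = log B − log A` the renormalised two-run log-increment, `c = log Z_B − log Z_A` the target constant, so that `log q − log p = h − c`:
* §1 ★ `gibbsBogoliubov_sandwich` — `E_p h ≤ c ≤ E_q h` (JENSEN for `exp` at the two endpoint laws: `exp(E_p h) ≤ E_p e^{h} = Z_B∕Z_A`, `exp(−E_q h) ≤ E_q e^{−h} = Z_A∕Z_B`;
  dag-n20-w4's FILE 1 `gibbsBogoliubov_gap_left∕_right` carry these bounds bundled with the s-uniform variance letter — here the pure sandwich, separately citable);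
  ★★ `one_sub_affinity_classLaw_le_wildMass_add_mixtureMoment` — `1 − Σ√(pq) ≤ ½·Σ_W(p+q) + ¼·Σ_{T∖W} ½(p+q)(h − c)²` for ANY wild set `W ⊆ T` (idea-3's Sketch §10
  `one_sub_bc_classLaw_le_wild_add_moment`, importable form) and its `W = ∅` form ★ `one_sub_affinity_classLaw_le_quarter_mixtureMoment`;
  ★ `mixtureMoment_logRatio_le_of_regime` — the bootstrap at the class weights (centring certified by the sandwich): regime ⇒ `Σ ½(p+q)(h − c)² ≤ Var_p h + Var_q h`,
  two ONE-RUN variances of the two-run observable `h` (dag-n19-w4 g5's `…N19VarianceOfAnalyticTilt.variance_le_of_analytic_tilt{_sharp}`, p614272, is the supplier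
  SHAPE for each).
* §2 THE TARGET SIDE: `hasDerivAt_log_total_sub_log_total` (differentiable class weights ⇒ `c'(t) = Z_B'∕Z_B − Z_A'∕Z_A`); ★ `response_split` — the ENDPOINT RESPONSE
  IDENTITY `Z_B'∕Z_B − Z_A'∕Z_A = E_q[B'∕B − A'∕A] + (E_q − E_p)[A'∕A]`; ★★ `abs_response_le` — `|c'| ≤ |E_q ∂h| + 2√(2(1 − Σ√(pq)))·√(Σ ½(p+q)(j − m)²)`, `j = A'∕A`, any
  centring `m` (the cross term is PAID BY the V-side functional × a one-run susceptibility — FILE 1a's coupling lemma); `matchingModConstants_of_derivative_bound`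
  (the mean-value step on `|s| ≤ l₀` to the `|c(t) − c(0)| ≤ r·l₀` shape of `T4CauchySum.MatchingModConstants` at one `K`).
CREDIT.  idea-3 g11's Sketch §6b∕§10 (Cruxes workfile, re-proved here); CRIT-1 g5 §2 (b)–(d).  dag-n19-w4 g4's `…N19ClassMeanResponseCalculus` is ed.1's response of
the run-A CLASS MEAN (one law's covariance) — a different object; disjoint.

HONEST FRAMING.  [folklore] finite-sum real analysis (Jensen, Cauchy–Schwarz, the mean-value inequality) on hypothesis SHAPES; every letter (weights, derivative
carriers, the regime) is a HYPOTHESIS produced by nobody — (YG) ∕ (R′) are NOT PRINTED for d = 4 and NOT asserted; NO estimate of Bałaban's programme is proved;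
nothing of Bałaban's asserted or instantiated (K0⁷ OPEN); NE7 ∕ NE7b ∕ NE7c NOT PRINTED for d = 4 and NOT proved; N19 ∕ N20 ∕ N21 NOT discharged; K3⁷ OPEN, v5
STANDS, not claimed; no summit statement is proved by this seat; counts UNMOVED (typed 28∕28 · discharged 5∕27, A 5∕28).  NOT ℝ⁴, NOT infinite volume, NOT OS, NOT
a mass gap, NOT the Clay problem (R4 = the conditional finite-𝕋⁴ rung `BalabanLadder.UV` only).  0 `def`; 0 `sorry`; standard axioms; no cite tags.
-/

noncomputable section

namespace Summit.QuantumFields.YangMills.BalabanUVNodes.N20HellingerEndpointClassWeights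

open Finset
open Summit.QuantumFields.YangMills.BalabanUVNodes.N19AffinityClassIndexLaws (div_total_nonneg sum_div_total_eq_one)
open Summit.QuantumFields.YangMills.BalabanUVNodes.N20HellingerEndpointKernel

variable {ι : Type*}


/-! ## §1 At the two runs' class weights: the Gibbs–Bogoliubov sandwich and the V-side in increment letters [folklore] -/

section ClassWeights
variable {T : Finset ι} {A B : ι → ℝ}

/-- **★ THE CLASS-LEVEL GIBBS–BOGOLIUBOV SANDWICH** [folklore; JENSEN for `exp` at the two ENDPOINT laws — idea-3's Sketch §6b `gibbs_bogoliubov_sandwich`, importable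
form].  Positive class weights `A, B` on `T` with `p = A∕Z_A`, `q = B∕Z_B`, `h = log B − log A`: `E_p h ≤ log Z_B − log Z_A ≤ E_q h` — the target constant is
sandwiched by the two runs' ONE-RUN-LAW means of the two-run increment (`exp(E_p h) ≤ E_p e^{h} = Z_B∕Z_A` and `exp(−E_q h) ≤ E_q e^{−h} = Z_A∕Z_B`).  This is the
centring condition of the bootstrap `mixtureMoment_le`.  No variance letter, no interpolation. -/
theorem gibbsBogoliubov_sandwich (hA : ∀ τ ∈ T, 0 < A τ) (hB : ∀ τ ∈ T, 0 < B τ)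
    (hZA : 0 < ∑ τ ∈ T, A τ) (hZB : 0 < ∑ τ ∈ T, B τ) :
    ∑ τ ∈ T, A τ / (∑ σ ∈ T, A σ) * (Real.log (B τ) - Real.log (A τ))
        ≤ Real.log (∑ τ ∈ T, B τ) - Real.log (∑ τ ∈ T, A τ) ∧
      Real.log (∑ τ ∈ T, B τ) - Real.log (∑ τ ∈ T, A τ)
        ≤ ∑ τ ∈ T, B τ / (∑ σ ∈ T, B σ) * (Real.log (B τ) - Real.log (A τ)) := by
  have hp0 := div_total_nonneg T (fun τ hτ => (hA τ hτ).le) hZA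
  have hp1 := sum_div_total_eq_one T (A := A) hZA
  have hq0 := div_total_nonneg T (fun τ hτ => (hB τ hτ).le) hZB
  have hq1 := sum_div_total_eq_one T (A := B) hZB
  constructor
  · -- Jensen under `p` with the observable `h`: `exp (E_p h) ≤ E_p (exp h) = Z_B ∕ Z_A`
    have hJ := (convexOn_exp).map_sum_le hp0 hp1 (fun τ _ => Set.mem_univ (Real.log (B τ) - Real.log (A τ)))
    simp only [smul_eq_mul] at hJ
    have e : ∑ τ ∈ T, A τ / (∑ σ ∈ T, A σ) * Real.exp (Real.log (B τ) - Real.log (A τ))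
        = (∑ τ ∈ T, B τ) / ∑ σ ∈ T, A σ := by
      rw [sum_div]
      refine sum_congr rfl fun τ hτ => ?_
      rw [Real.exp_sub, Real.exp_log (hB τ hτ), Real.exp_log (hA τ hτ)]
      field_simp [(hA τ hτ).ne']
    rw [e] at hJ
    rw [← Real.log_div hZB.ne' hZA.ne', Real.le_log_iff_exp_le (div_pos hZB hZA)]
    exact hJ
  · -- Jensen under `q` with the observable `−h`: `exp (−E_q h) ≤ E_q (exp (−h)) = Z_A ∕ Z_B`
    have hJ := (convexOn_exp).map_sum_le hq0 hq1 (fun τ _ => Set.mem_univ (-(Real.log (B τ) - Real.log (A τ))))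
    simp only [smul_eq_mul] at hJ
    have e : ∑ τ ∈ T, B τ / (∑ σ ∈ T, B σ) * Real.exp (-(Real.log (B τ) - Real.log (A τ)))
        = (∑ τ ∈ T, A τ) / ∑ σ ∈ T, B σ := by
      rw [sum_div]
      refine sum_congr rfl fun τ hτ => ?_
      rw [neg_sub, Real.exp_sub, Real.exp_log (hB τ hτ), Real.exp_log (hA τ hτ)]
      field_simp [(hB τ hτ).ne']
    have e2 : ∑ τ ∈ T, B τ / (∑ σ ∈ T, B σ) * (-(Real.log (B τ) - Real.log (A τ)))
        = -∑ τ ∈ T, B τ / (∑ σ ∈ T, B σ) * (Real.log (B τ) - Real.log (A τ)) := by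
      rw [← sum_neg_distrib]; exact sum_congr rfl fun τ _ => by ring
    rw [e, e2] at hJ
    have h3 : -∑ τ ∈ T, B τ / (∑ σ ∈ T, B σ) * (Real.log (B τ) - Real.log (A τ))
        ≤ Real.log (∑ τ ∈ T, A τ) - Real.log (∑ τ ∈ T, B τ) := by
      rw [← Real.log_div hZA.ne' hZB.ne', Real.le_log_iff_exp_le (div_pos hZA hZB)]
      exact hJ
    linarith

/-- [bookkeeping] for class weights the log-ratio of the LAWS is the CENTRED increment: `log q − log p = h − c`, `h = log B − log A`,
`c = log Z_B − log Z_A`. -/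
theorem log_classLaw_sub_log_classLaw (hA : ∀ τ ∈ T, 0 < A τ) (hB : ∀ τ ∈ T, 0 < B τ)
    (hZA : 0 < ∑ τ ∈ T, A τ) (hZB : 0 < ∑ τ ∈ T, B τ) {τ : ι} (hτ : τ ∈ T) :
    Real.log (A τ / ∑ σ ∈ T, A σ) - Real.log (B τ / ∑ σ ∈ T, B σ)
      = -((Real.log (B τ) - Real.log (A τ)) - (Real.log (∑ σ ∈ T, B σ) - Real.log (∑ σ ∈ T, A σ))) := by
  rw [Real.log_div (hA τ hτ).ne' hZA.ne', Real.log_div (hB τ hτ).ne' hZB.ne']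
  ring

/-- **★★ THE V-SIDE AT THE CLASS WEIGHTS, WITH A WILD SET** [folklore; idea-3's Sketch §10 `one_sub_bc_classLaw_le_wild_add_moment`, importable form].  Positive class
weights, `p = A∕Z_A`, `q = B∕Z_B`, `h = log B − log A`, `c = log Z_B − log Z_A`, any `W ⊆ T`:
`1 − Σ_T √(pq) ≤ ½·Σ_W (p + q) + ¼·Σ_{T∖W} ½(p + q)(h − c)²` — the K1 supply of the road is WILD MASS under each run's own law plus the SECOND MOMENT OF THE
CENTRED TWO-RUN INCREMENT UNDER THE MIXTURE of the two one-run class laws. -/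
theorem one_sub_affinity_classLaw_le_wildMass_add_mixtureMoment [DecidableEq ι] (hA : ∀ τ ∈ T, 0 < A τ) (hB : ∀ τ ∈ T, 0 < B τ)
    (hZA : 0 < ∑ τ ∈ T, A τ) (hZB : 0 < ∑ τ ∈ T, B τ) {W : Finset ι} (hW : W ⊆ T) :
    1 - ∑ τ ∈ T, Real.sqrt ((A τ / ∑ σ ∈ T, A σ) * (B τ / ∑ σ ∈ T, B σ))
      ≤ (∑ τ ∈ W, (A τ / (∑ σ ∈ T, A σ) + B τ / (∑ σ ∈ T, B σ))) / 2
        + (∑ τ ∈ T \ W, (A τ / (∑ σ ∈ T, A σ) + B τ / (∑ σ ∈ T, B σ)) / 2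
            * ((Real.log (B τ) - Real.log (A τ)) - (Real.log (∑ σ ∈ T, B σ) - Real.log (∑ σ ∈ T, A σ))) ^ 2) / 4 := by
  have hp' : ∀ τ ∈ T \ W, 0 < A τ / ∑ σ ∈ T, A σ := fun τ hτ => div_pos (hA τ (sdiff_subset hτ)) hZA
  have hq' : ∀ τ ∈ T \ W, 0 < B τ / ∑ σ ∈ T, B σ := fun τ hτ => div_pos (hB τ (sdiff_subset hτ)) hZB
  have h := one_sub_affinity_le_wildMass_add_logMoment (div_total_nonneg T (fun τ hτ => (hA τ hτ).le) hZA)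
    (div_total_nonneg T (fun τ hτ => (hB τ hτ).le) hZB) (sum_div_total_eq_one T hZA) (sum_div_total_eq_one T hZB) hW hp' hq'
  have e2 : ∑ τ ∈ T \ W, (A τ / (∑ σ ∈ T, A σ) + B τ / (∑ σ ∈ T, B σ))
        * (Real.log (A τ / ∑ σ ∈ T, A σ) - Real.log (B τ / ∑ σ ∈ T, B σ)) ^ 2
      = ∑ τ ∈ T \ W, (A τ / (∑ σ ∈ T, A σ) + B τ / (∑ σ ∈ T, B σ))
        * ((Real.log (B τ) - Real.log (A τ)) - (Real.log (∑ σ ∈ T, B σ) - Real.log (∑ σ ∈ T, A σ))) ^ 2 := by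
    refine sum_congr rfl fun τ hτ => ?_
    rw [log_classLaw_sub_log_classLaw hA hB hZA hZB (sdiff_subset hτ), neg_sq]
  have e3 : (∑ τ ∈ T \ W, (A τ / (∑ σ ∈ T, A σ) + B τ / (∑ σ ∈ T, B σ)) / 2
            * ((Real.log (B τ) - Real.log (A τ)) - (Real.log (∑ σ ∈ T, B σ) - Real.log (∑ σ ∈ T, A σ))) ^ 2) / 4
      = (∑ τ ∈ T \ W, (A τ / (∑ σ ∈ T, A σ) + B τ / (∑ σ ∈ T, B σ))
            * ((Real.log (B τ) - Real.log (A τ)) - (Real.log (∑ σ ∈ T, B σ) - Real.log (∑ σ ∈ T, A σ))) ^ 2) / 8 := by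
    have h4 : ∑ τ ∈ T \ W, (A τ / (∑ σ ∈ T, A σ) + B τ / (∑ σ ∈ T, B σ)) / 2
            * ((Real.log (B τ) - Real.log (A τ)) - (Real.log (∑ σ ∈ T, B σ) - Real.log (∑ σ ∈ T, A σ))) ^ 2
        = (∑ τ ∈ T \ W, (A τ / (∑ σ ∈ T, A σ) + B τ / (∑ σ ∈ T, B σ))
            * ((Real.log (B τ) - Real.log (A τ)) - (Real.log (∑ σ ∈ T, B σ) - Real.log (∑ σ ∈ T, A σ))) ^ 2) / 2 := by
      rw [sum_div]; exact sum_congr rfl fun τ _ => by ring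
    rw [h4]; ring
  rw [e2] at h
  rw [e3]
  exact h

/-- **★ THE V-SIDE, NO WILD SET** [folklore]: `1 − Σ_T √(pq) ≤ ¼·Σ_T ½(p + q)(h − c)²` — the affinity defect of the two runs' class laws is at most a quarter of the
mixture second moment of the centred increment. -/
theorem one_sub_affinity_classLaw_le_quarter_mixtureMoment [DecidableEq ι] (hA : ∀ τ ∈ T, 0 < A τ) (hB : ∀ τ ∈ T, 0 < B τ)
    (hZA : 0 < ∑ τ ∈ T, A τ) (hZB : 0 < ∑ τ ∈ T, B τ) :
    1 - ∑ τ ∈ T, Real.sqrt ((A τ / ∑ σ ∈ T, A σ) * (B τ / ∑ σ ∈ T, B σ))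
      ≤ (∑ τ ∈ T, (A τ / (∑ σ ∈ T, A σ) + B τ / (∑ σ ∈ T, B σ)) / 2
            * ((Real.log (B τ) - Real.log (A τ)) - (Real.log (∑ σ ∈ T, B σ) - Real.log (∑ σ ∈ T, A σ))) ^ 2) / 4 := by
  have h := one_sub_affinity_classLaw_le_wildMass_add_mixtureMoment hA hB hZA hZB (empty_subset T)
  rwa [sum_empty, zero_div, zero_add, sdiff_empty] at h

/-- **★ THE BOOTSTRAP AT THE CLASS WEIGHTS** [folklore]: in the regime `1 − Σ√(pq) ≤ 1∕16` the mixture second moment of the centred increment is at most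
`Var_p h + Var_q h` — two ONE-RUN variances of the two-run observable `h = log B − log A` (the centring `c = log Z_B − log Z_A` lies between the two means by
`gibbsBogoliubov_sandwich`).  With `one_sub_affinity_classLaw_le_quarter_mixtureMoment`: `1 − Σ√(pq) ≤ ¼(Var_p h + Var_q h)` in the regime. -/
theorem mixtureMoment_logRatio_le_of_regime (hA : ∀ τ ∈ T, 0 < A τ) (hB : ∀ τ ∈ T, 0 < B τ)
    (hZA : 0 < ∑ τ ∈ T, A τ) (hZB : 0 < ∑ τ ∈ T, B τ)
    (hreg : 1 - ∑ τ ∈ T, Real.sqrt ((A τ / ∑ σ ∈ T, A σ) * (B τ / ∑ σ ∈ T, B σ)) ≤ 1 / 16) :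
    ∑ τ ∈ T, (A τ / (∑ σ ∈ T, A σ) + B τ / (∑ σ ∈ T, B σ)) / 2
        * ((Real.log (B τ) - Real.log (A τ)) - (Real.log (∑ σ ∈ T, B σ) - Real.log (∑ σ ∈ T, A σ))) ^ 2
      ≤ (∑ τ ∈ T, A τ / (∑ σ ∈ T, A σ) * ((Real.log (B τ) - Real.log (A τ))
            - ∑ σ ∈ T, A σ / (∑ σ' ∈ T, A σ') * (Real.log (B σ) - Real.log (A σ))) ^ 2)
        + ∑ τ ∈ T, B τ / (∑ σ ∈ T, B σ) * ((Real.log (B τ) - Real.log (A τ))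
            - ∑ σ ∈ T, B σ / (∑ σ' ∈ T, B σ') * (Real.log (B σ) - Real.log (A σ))) ^ 2 := by
  have hs := gibbsBogoliubov_sandwich hA hB hZA hZB
  exact mixtureMoment_le_of_regime (div_total_nonneg T (fun τ hτ => (hA τ hτ).le) hZA) (div_total_nonneg T (fun τ hτ => (hB τ hτ).le) hZB)
    (sum_div_total_eq_one T hZA) (sum_div_total_eq_one T hZB) (fun τ => Real.log (B τ) - Real.log (A τ)) hs.1 hs.2 hreg

end ClassWeights

/-! ## §2 The target side: the endpoint response identity, its one-key bound, and the mean-value step [folklore] -/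

section Target
variable {T : Finset ι}

/-- **ENDPOINT RESPONSE, derivative form** [folklore calculus]: if every class weight of both runs is differentiable in the source parameter at `t` and the
totals do not vanish there, the target function `c(s) = log Z_B(s) − log Z_A(s)` has derivative `Z_B'∕Z_B − Z_A'∕Z_A` at `t`. -/
theorem hasDerivAt_log_total_sub_log_total {A B : ℝ → ι → ℝ} {A' B' : ι → ℝ} {t : ℝ}
    (hA : ∀ τ ∈ T, HasDerivAt (fun s => A s τ) (A' τ) t) (hB : ∀ τ ∈ T, HasDerivAt (fun s => B s τ) (B' τ) t)
    (hZA : ∑ τ ∈ T, A t τ ≠ 0) (hZB : ∑ τ ∈ T, B t τ ≠ 0) :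
    HasDerivAt (fun s => Real.log (∑ τ ∈ T, B s τ) - Real.log (∑ τ ∈ T, A s τ))
      ((∑ τ ∈ T, B' τ) / (∑ τ ∈ T, B t τ) - (∑ τ ∈ T, A' τ) / (∑ τ ∈ T, A t τ)) t := by
  have hSA : HasDerivAt (fun s => ∑ τ ∈ T, A s τ) (∑ τ ∈ T, A' τ) t := HasDerivAt.fun_sum hA
  have hSB : HasDerivAt (fun s => ∑ τ ∈ T, B s τ) (∑ τ ∈ T, B' τ) t := HasDerivAt.fun_sum hB
  exact (hSB.log hZB).sub (hSA.log hZA)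

/-- **★ THE ENDPOINT RESPONSE IDENTITY** [algebra; idea-3's Sketch §10 `response_split`, importable form].  With `p = A∕Z_A`, `q = B∕Z_B` the two ONE-RUN class laws,
`Z_B'∕Z_B − Z_A'∕Z_A = E_q[B'∕B − A'∕A] + (E_q[A'∕A] − E_p[A'∕A])` — the RESPONSE of the increment's derivative `∂h = ∂log B − ∂log A` under run B's law, plus the
COUPLING term: the run-A source current `j = ∂log A` tested against the difference of the two one-run laws.  No interpolated ensemble. -/
theorem response_split {A B A' B' : ι → ℝ} (hA : ∀ τ ∈ T, A τ ≠ 0) (hB : ∀ τ ∈ T, B τ ≠ 0) :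
    (∑ τ ∈ T, B' τ) / (∑ τ ∈ T, B τ) - (∑ τ ∈ T, A' τ) / (∑ τ ∈ T, A τ)
      = ∑ τ ∈ T, B τ / (∑ σ ∈ T, B σ) * (B' τ / B τ - A' τ / A τ)
        + (∑ τ ∈ T, B τ / (∑ σ ∈ T, B σ) * (A' τ / A τ) - ∑ τ ∈ T, A τ / (∑ σ ∈ T, A σ) * (A' τ / A τ)) := by
  have e1 : ∑ τ ∈ T, B τ / (∑ σ ∈ T, B σ) * (B' τ / B τ) = (∑ τ ∈ T, B' τ) / ∑ σ ∈ T, B σ := by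
    rw [sum_div]
    exact sum_congr rfl fun τ hτ => by rw [div_mul_div_comm, mul_comm (B τ) (B' τ), mul_div_mul_right _ _ (hB τ hτ)]
  have e2 : ∑ τ ∈ T, A τ / (∑ σ ∈ T, A σ) * (A' τ / A τ) = (∑ τ ∈ T, A' τ) / ∑ σ ∈ T, A σ := by
    rw [sum_div]
    exact sum_congr rfl fun τ hτ => by rw [div_mul_div_comm, mul_comm (A τ) (A' τ), mul_div_mul_right _ _ (hA τ hτ)]
  have e3 : ∑ τ ∈ T, B τ / (∑ σ ∈ T, B σ) * (B' τ / B τ - A' τ / A τ)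
      = ∑ τ ∈ T, B τ / (∑ σ ∈ T, B σ) * (B' τ / B τ) - ∑ τ ∈ T, B τ / (∑ σ ∈ T, B σ) * (A' τ / A τ) := by
    rw [← sum_sub_distrib]
    exact sum_congr rfl fun τ _ => by ring
  rw [e3, e1, e2]
  ring

/-- **★★ THE ONE-KEY KERNEL OF THE TARGET** [folklore; idea-3's Sketch §10 `abs_response_le`, importable form]: for positive class weights, any derivative carriers
`A', B'` and any centring `m`, `|Z_B'∕Z_B − Z_A'∕Z_A| ≤ |E_q[B'∕B − A'∕A]| + 2·√(2(1 − Σ√(pq)))·√(Σ ½(p+q)(A'∕A − m)²)` — the response of the target constant to the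
source is the ONE-RUN-LAW expectation of the increment's derivative plus (the Hellinger functional of the V-side) × (a one-run source susceptibility). -/
theorem abs_response_le {A B : ι → ℝ} (hA : ∀ τ ∈ T, 0 < A τ) (hB : ∀ τ ∈ T, 0 < B τ)
    (hZA : 0 < ∑ τ ∈ T, A τ) (hZB : 0 < ∑ τ ∈ T, B τ) (A' B' : ι → ℝ) (m : ℝ) :
    |(∑ τ ∈ T, B' τ) / (∑ τ ∈ T, B τ) - (∑ τ ∈ T, A' τ) / (∑ τ ∈ T, A τ)|
      ≤ |∑ τ ∈ T, B τ / (∑ σ ∈ T, B σ) * (B' τ / B τ - A' τ / A τ)|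
        + 2 * Real.sqrt (2 * (1 - ∑ τ ∈ T, Real.sqrt ((A τ / ∑ σ ∈ T, A σ) * (B τ / ∑ σ ∈ T, B σ))))
          * Real.sqrt (∑ τ ∈ T, (A τ / (∑ σ ∈ T, A σ) + B τ / (∑ σ ∈ T, B σ)) / 2 * (A' τ / A τ - m) ^ 2) := by
  rw [response_split (fun τ hτ => (hA τ hτ).ne') (fun τ hτ => (hB τ hτ).ne')]
  have hc := abs_mean_sub_mean_le_hellinger (div_total_nonneg T (fun τ hτ => (hA τ hτ).le) hZA)
    (div_total_nonneg T (fun τ hτ => (hB τ hτ).le) hZB) (sum_div_total_eq_one T hZA) (sum_div_total_eq_one T hZB) (fun τ => A' τ / A τ) m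
  exact (abs_add_le _ _).trans (add_le_add le_rfl hc)

/-- **THE MEAN-VALUE STEP TO THE TARGET SHAPE** [folklore; idea-3's `matching_of_derivative_bound`]: a function differentiable on `|s| ≤ l₀` (`0 ≤ l₀`) with `|c'| ≤ r`
there is matched modulo the constant `c 0` within `r·l₀` — the `∀ t, |t| ≤ l₀ → |log Z_{K+1}(t) − log Z_K(t) − c_K| ≤ vol·δ_K` shape of
`T4CauchySum.MatchingModConstants` at one `K`, with `vol·δ_K = l₀·sup_{|s|≤l₀} |c_K'(s)|`. -/
theorem matchingModConstants_of_derivative_bound {l₀ r : ℝ} {c c' : ℝ → ℝ} (hl₀ : 0 ≤ l₀)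
    (hc : ∀ s, |s| ≤ l₀ → HasDerivAt c (c' s) s) (hb : ∀ s, |s| ≤ l₀ → |c' s| ≤ r) :
    ∀ t, |t| ≤ l₀ → |c t - c 0| ≤ r * l₀ := by
  intro t ht
  have hmem : ∀ {s : ℝ}, s ∈ Set.Icc (-l₀) l₀ ↔ |s| ≤ l₀ := fun {s} => by rw [Set.mem_Icc, abs_le]
  have h0 : |(0:ℝ)| ≤ l₀ := by simpa using hl₀
  have key : ‖c t - c 0‖ ≤ r * ‖t - 0‖ :=
    (convex_Icc (-l₀) l₀).norm_image_sub_le_of_norm_hasDerivWithin_le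
      (fun s hs => (hc s (hmem.mp hs)).hasDerivWithinAt)
      (fun s hs => by rw [Real.norm_eq_abs]; exact hb s (hmem.mp hs))
      (hmem.mpr h0) (hmem.mpr ht)
  rw [Real.norm_eq_abs, Real.norm_eq_abs, sub_zero] at key
  have hr : 0 ≤ r := (abs_nonneg _).trans (hb 0 h0)
  exact key.trans (mul_le_mul_of_nonneg_left ht hr)

end Target

end Summit.QuantumFields.YangMills.BalabanUVNodes.N20HellingerEndpointClassWeights
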